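import Summits.Ventures.PercRepro.C041TriangleDict
import Summits.Ventures.PercRepro.C041RelaxedTriangleMain
import Summits.Ventures.PercRepro.C041TriangleMixedFamily
import Summits.Ventures.PercRepro.C041ConeClassE

/-!
# ROW C-041 — THE TRIANGLE ZONE ON THE GRAPH MODEL: (P), the one-anchor (CS), the ZONE O-CUBE and the cone, by
name (p6, gen 31; the consequences of THE TRIANGLE DICTIONARY `sixVec_tri2` of `C041TriangleDict` for mine-3's
theorems on `thetaTri`)

`tri2 Z a Z' a'` is the triangle `a – u – u' – a` with the zone `Z` hung at `u` and `Z'` at `u'`, and its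
six-vector IS `thetaTri (Π Z) (Π Z')`.  Hence, on the graph model:

* **THEOREM (RELAXED TRIANGLE), zone form** (`K4_tri2_of_rel`, `zoneCSConj_tri2_of_rel`,
  `zoneOCubeConj_tri2_of_rel`): if the six-vectors of the two zones lie in mine-3's relaxed domain `Rel` — (P)
  and the trivial bounds — the triangle zone satisfies (P), hence the one-anchor (CS) and the ZONE O-CUBE
  (`C041RelaxedTriangleMain`: `K4v_thetaTri_of_rel`);
* the same for two CONE inputs (`zoneOCubeConj_tri2_of_inCone`) and for two members of the class `IsZe`
  (single marked vertices, stars, trees, pendant and anchor gluings …; `zoneOCubeConj_tri2_of_isZe`);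
* **the triangle with two MARKED VERTICES of any marks is IN THE CONE** (`inCone_sixVec_tri2_point`, from
  mine-3's `InCone_thetaTri_marks` of `C041TriangleMixedFamily` and the seed `sixVec_pointZone`), hence it
  satisfies the ZONE O-CUBE (`zoneOCubeConj_tri2_point`) — CONJECTURE (CONE) of C-041.md §19 (i) for the
  triangle with two marked vertices, on the graph model, with no hypothesis.

Two general steps first: (P) of the six-vector gives the one-anchor (CS) and the ZONE O-CUBE
(`zoneCSConj_of_K4v_sixVec`, `zoneOCubeConj_of_K4v_sixVec`; the `InCone` versions are in `C041SixVec`).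
-/

namespace PercRepro

namespace ZoneZ

/-! ## (P) of the six-vector gives (CS) and the O-cube -/

namespace ZoneData

open TreeClosure Finset

variable {V E T₁ T₂ : Type*} (Z : ZoneData V E T₁ T₂) (k : V)
variable [Fintype E] [DecidableEq E] [Fintype T₁] [DecidableEq T₁] [Fintype T₂] [DecidableEq T₂]

/-- (P) of the six-vector gives the one-anchor (CS). -/
theorem zoneCSConj_of_K4v_sixVec (h : K4v (Z.sixVec k)) : Z.ZoneCSConj {k} (∅ : Set V) := by
  have hK := (Z.K4v_sixVec_iff k).1 h
  rw [zoneCSConj_single_iff]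
  have hle : #(Z.Iset k) ≤ #(Z.Fset k) := by exact_mod_cast hK.k_le_g
  have h2 : (((#(Z.Fset k) - #(Z.Iset k) : ℕ) : ℝ)) ^ 2 ≤ ((#(Z.T1set k) * #(Z.T2set k) : ℕ) : ℝ) := by
    rw [Nat.cast_sub hle]
    push_cast
    exact hK.cs
  exact_mod_cast h2

/-- (P) of the six-vector gives the ZONE O-CUBE. -/
theorem zoneOCubeConj_of_K4v_sixVec (h : K4v (Z.sixVec k)) : Z.ZoneOCubeConj {k} (∅ : Set V) :=
  zoneOCubeConj_of_zoneCS Z {k} ∅ (Z.zoneCSConj_of_K4v_sixVec k h)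

end ZoneData

namespace TwoExit

open ZoneData TreeClosure RelaxedTriangle Finset

variable {V E T₁ T₂ V' E' T₁' T₂' : Type} (Z : ZoneData V E T₁ T₂) (a : V) (Z' : ZoneData V' E' T₁' T₂') (a' : V')
variable [Fintype E] [DecidableEq E] [Fintype T₁] [DecidableEq T₁] [Fintype T₂] [DecidableEq T₂] [Fintype E']
  [DecidableEq E'] [Fintype T₁'] [DecidableEq T₁'] [Fintype T₂'] [DecidableEq T₂']

/-! ## THEOREM (RELAXED TRIANGLE), zone form -/

/-- **(P) on the triangle zone** from two relaxed inputs ((P) and the trivial bounds at the exits). -/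
theorem K4v_sixVec_tri2_of_rel (h : RelaxedTriangle.Rel (Z.sixVec a)) (h' : RelaxedTriangle.Rel (Z'.sixVec a')) :
    K4v ((tri2 Z a Z' a').sixVec (Sum.inl (Sum.inl 0))) := by
  rw [sixVec_tri2]
  exact K4v_thetaTri_of_rel h h'

/-- **(P) on the four counts of the triangle zone** from two relaxed inputs. -/
theorem K4_tri2_of_rel (h : RelaxedTriangle.Rel (Z.sixVec a)) (h' : RelaxedTriangle.Rel (Z'.sixVec a')) :
    K4 (#((tri2 Z a Z' a').Fset (Sum.inl (Sum.inl 0))) : ℝ) (#((tri2 Z a Z' a').T1set (Sum.inl (Sum.inl 0))))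
      (#((tri2 Z a Z' a').T2set (Sum.inl (Sum.inl 0)))) (#((tri2 Z a Z' a').Iset (Sum.inl (Sum.inl 0)))) :=
  ((tri2 Z a Z' a').K4v_sixVec_iff _).1 (K4v_sixVec_tri2_of_rel Z a Z' a' h h')

/-- **The one-anchor (CS) on the triangle zone** from two relaxed inputs. -/
theorem zoneCSConj_tri2_of_rel (h : RelaxedTriangle.Rel (Z.sixVec a)) (h' : RelaxedTriangle.Rel (Z'.sixVec a')) :
    (tri2 Z a Z' a').ZoneCSConj {Sum.inl (Sum.inl 0)} (∅ : Set ((Fin 3 ⊕ V') ⊕ V)) :=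
  (tri2 Z a Z' a').zoneCSConj_of_K4v_sixVec _ (K4v_sixVec_tri2_of_rel Z a Z' a' h h')

/-- **THEOREM (RELAXED TRIANGLE), zone form: the ZONE O-CUBE on the triangle zone** from two relaxed inputs. -/
theorem zoneOCubeConj_tri2_of_rel (h : RelaxedTriangle.Rel (Z.sixVec a)) (h' : RelaxedTriangle.Rel (Z'.sixVec a')) :
    (tri2 Z a Z' a').ZoneOCubeConj {Sum.inl (Sum.inl 0)} (∅ : Set ((Fin 3 ⊕ V') ⊕ V)) :=
  (tri2 Z a Z' a').zoneOCubeConj_of_K4v_sixVec _ (K4v_sixVec_tri2_of_rel Z a Z' a' h h')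

/-! ## Cone inputs and class members -/

/-- (P) on the triangle zone from two cone inputs. -/
theorem K4v_sixVec_tri2_of_inCone (h : InCone (Z.sixVec a)) (h' : InCone (Z'.sixVec a')) :
    K4v ((tri2 Z a Z' a').sixVec (Sum.inl (Sum.inl 0))) :=
  K4v_sixVec_tri2_of_rel Z a Z' a' (Rel_of_InCone h) (Rel_of_InCone h')

/-- The ZONE O-CUBE on the triangle zone from two cone inputs. -/
theorem zoneOCubeConj_tri2_of_inCone (h : InCone (Z.sixVec a)) (h' : InCone (Z'.sixVec a')) :
    (tri2 Z a Z' a').ZoneOCubeConj {Sum.inl (Sum.inl 0)} (∅ : Set ((Fin 3 ⊕ V') ⊕ V)) :=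
  (tri2 Z a Z' a').zoneOCubeConj_of_K4v_sixVec _ (K4v_sixVec_tri2_of_inCone Z a Z' a' h h')

/-- **The ZONE O-CUBE on the triangle zone with two members of the class `IsZe` at its exits.** -/
theorem zoneOCubeConj_tri2_of_isZe (h : IsZe Z a) (h' : IsZe Z' a') :
    (tri2 Z a Z' a').ZoneOCubeConj {Sum.inl (Sum.inl 0)} (∅ : Set ((Fin 3 ⊕ V') ⊕ V)) :=
  zoneOCubeConj_tri2_of_inCone Z a Z' a' (h.inCone _ _ _ _ _ _) (h'.inCone _ _ _ _ _ _)

/-! ## Two marked vertices -/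

open PointZone in
/-- **The triangle with two marked vertices of any marks is IN THE CONE** (`p` red-type-`1` marks and `q`
type-`2` marks at `u`, `p'` and `q'` at `u'`). -/
theorem inCone_sixVec_tri2_point (p q p' q' : ℕ) :
    InCone ((tri2 (pointZone p q) () (pointZone p' q') ()).sixVec (Sum.inl (Sum.inl 0))) := by
  rw [sixVec_tri2, sixVec_pointZone, sixVec_pointZone, one_mul, one_mul]
  exact InCone_thetaTri_marks p q p' q'

open PointZone in
/-- **CONJECTURE (CONE) FOR THE TRIANGLE WITH TWO MARKED VERTICES, on the graph model**: the ZONE O-CUBE holds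
on the triangle `a – u – u' – a` carrying `p` / `q` marks at `u` and `p'` / `q'` marks at `u'`, for all
`p q p' q'`. -/
theorem zoneOCubeConj_tri2_point (p q p' q' : ℕ) :
    (tri2 (pointZone p q) () (pointZone p' q') ()).ZoneOCubeConj {Sum.inl (Sum.inl 0)}
      (∅ : Set ((Fin 3 ⊕ Unit) ⊕ Unit)) :=
  (tri2 (pointZone p q) () (pointZone p' q') ()).zoneOCubeConj_of_inCone_sixVec _
    (inCone_sixVec_tri2_point p q p' q')

open PointZone in
/-- The one-anchor (CS) on the triangle with two marked vertices. -/
theorem zoneCSConj_tri2_point (p q p' q' : ℕ) :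
    (tri2 (pointZone p q) () (pointZone p' q') ()).ZoneCSConj {Sum.inl (Sum.inl 0)}
      (∅ : Set ((Fin 3 ⊕ Unit) ⊕ Unit)) :=
  (tri2 (pointZone p q) () (pointZone p' q') ()).zoneCSConj_of_inCone_sixVec _
    (inCone_sixVec_tri2_point p q p' q')

end TwoExit

end ZoneZ

end PercRepro
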